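import Summits.HubbardSuperconductivity.HubbardSuperconductivity.Theorems.ChiralWindowCwChannelInfContinuousAssembly
import Literature.MathematicalPhysics.QuantumLattice.HubbardPairEnergySublevel
import Literature.MathematicalPhysics.QuantumLattice.HubbardBandShellVolume
import HarnessLib

/-!
# Route `ChiralWindow`, support `CwChannelInfContinuous` (item `stmt-HubbardSuperconductivity-1744`):
the closing theorem

`CwChannelInfContinuous` — continuity of `δ ↦ channelInf ε (μ(1-δ)) U χ` on the doping window
`[1/4, 12/25]` for the square lattice `ε = squareDispersion 1 0` — follows from
`cwChannelInfContinuous_of_estimates` (`…Assembly`: reduction to `μ`-continuity on the band,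
transport of channel states between levels, Hilbert–Schmidt control, and the `L²(dθdθ')`-continuity
of the weighted polar Kohn–Luttinger kernel derived from two geometric estimates) fed with the two
estimates now PROVED in the Literature:

* (TSL) `Literature…exists_torusSublevel_le` — the torus sublevel estimate for the pair energy
  `ε(p + γ_μ(θ) + γ_μ(θ'))` with exponent `β = 1/2` (second-order van der Corput along three slice
  directions, uniformly on compact sub-bands);
* (SV) `Literature…exists_shellVolume_le` — the shell-volume estimate `|BZ ∩ {|ε-μ|<t}| ≤ C t`.

No hypotheses, no definitions. [folklore]
-/

noncomputable section

-- the tree's namespace `Summit.<Summit>.<Problem>.Theorems` repeats the summit name by design (D-0017)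
set_option linter.dupNamespace false

namespace Summit.HubbardSuperconductivity.HubbardSuperconductivity.Theorems

open Literature.MathematicalPhysics.QuantumLattice

/-- **`CwChannelInfContinuous` holds**: for every coupling `U` and symmetry channel `χ`, the channel
bottom `δ ↦ channelInf ε (μ(1-δ)) U χ` of the Kohn–Luttinger pairing vertex of the square lattice
is continuous on the doping window `[1/4, 12/25]`. [folklore] -/
theorem cwChannelInfContinuous_proof :
    Summit.HubbardSuperconductivity.HubbardSuperconductivity.Theses.ChiralWindow.CwChannelInfContinuous :=
  cwChannelInfContinuous_of_estimates (fun _ _ h₁ h₂ => exists_torusSublevel_le h₁ h₂)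
    (fun _ _ h₁ h₂ => exists_shellVolume_le h₁ h₂)

end Summit.HubbardSuperconductivity.HubbardSuperconductivity.Theorems

end
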